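import Literature.NumberTheory.LFunctions.NoRealZeroCertificateReplayLightRows
import Literature.NumberTheory.LFunctions.NoRealZeroCertificateReplayHeavyCoverA
import Literature.NumberTheory.LFunctions.NoRealZeroCertificateReplayHeavyCoverB
import Literature.NumberTheory.LFunctions.NoRealZeroCertificateReplayHeavyCoverC
import Literature.NumberTheory.LFunctions.NoRealZeroCertificateReplayHeavyCoverD
import Literature.NumberTheory.LFunctions.NoRealZeroCertificateReplayUpTo
import Literature.NumberTheory.LFunctions.RealCharacterLadderLeaves
import Literature.NumberTheory.LFunctions.ExplicitExceptionalZeroBoundsEvenDerivative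
import HarnessLib

/-!
# No exceptional zero of quadratic Dirichlet `L`-functions up to `q = 4·10⁵` at width `1/5` — UNCONDITIONAL

Topic `Literature/NumberTheory/LFunctions`. This file DISCHARGES, inside `Literature/`, the named leaf
`NoExceptionalZeroUpTo_4e5_fifth` of `RealCharacterLadderLeaves.lean` (`= NoExceptionalZeroUpTo 400000 (1/5)`:
for every modulus `3 ≤ q ≤ 4·10⁵`, every primitive quadratic character `χ` mod `q` and every real
`σ ∈ (0, 1]` with `σ ≥ 1 − 1/(5 log q)`, `L(σ, χ) ≠ 0`) and, through the tree's reduction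
`Bordignon2020.bordignon2020_theorem13_of_noExceptionalZeroUpTo`, the named fact `bordignon2020_theorem13`
(Bordignon 2020, Theorem 1.3 as printed).

Everything load-bearing is ALREADY in `Literature/`; this file only assembles it (it is the Literature-side
twin of `Summits/Parity/GeneralizedHardyLittlewood/Theorems/LZZCertificateReplay{LightRows,HeavyRows,
UnconditionalLeaf}.lean`, whose three theorems it re-homes verbatim):

* the LIGHT layer `LuZamanZhao2026.Replay.lzzReplayK_lightRows :
  CertifiedRange (1/5) 23 400000 heavyList15` (`NoRealZeroCertificateReplayLightRows.lean`, the
  `CertifiedRange.append` of the 354 kernel-certified windows `NoRealZeroCertificateReplayRange001 … 354.lean`),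
  used as is;
* the HEAVY layer: the 354 chunk-coverage theorems `heavyChunk<k>_covered` of
  `NoRealZeroCertificateReplayHeavyCover{A,B,C,D}.lean`, joined along
  `heavyList15 = heavyChunk1 ++ (heavyChunk2 ++ …)` by `heavy_forall_append` — theorem
  `LuZamanZhao2026.Replay.heavyRows_fifth` below;
* the restricted analytic input `LuZamanZhao2026.theorem21UpTo_fourHundredThousand :
  theorem21UpTo 400000` (`RealZeroVonMangoldtSeriesBoundUpTo.lean`: Lu–Zaman–Zhao's Theorem 2.1 for
  moduli `q ≤ 4·10⁵` and real zeros in `(½, 1)`, PROVED from the classical global partial-fraction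
  inequality with the partner zero);
* the LIGHT/HEAVY glue `LuZamanZhao2026.Replay.noExceptionalZeroUpTo_of_light_heavy_upTo`
  (`NoRealZeroCertificateReplayUpTo.lean`).

Main statements:

* `LuZamanZhao2026.Replay.heavyRows_fifth` — every `D ∈ heavyList15` with `direct D = false` is
  `CertifiedAt (1/5) D`;
* **`NoExceptionalZeroUpTo_4e5_fifth_holds : NoExceptionalZeroUpTo_4e5_fifth`** — the EXACT discharge of
  the leaf (standard axioms; trust base = the Lean kernel);
* **`bordignon2020_theorem13_holds : bordignon2020_theorem13`** — Bordignon 2020 Theorem 1.3 («`χ` even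
  non-principal real, `q > 4·10⁵` ⟹ `β₀ ≤ 1 − 100/(√q log² q)`») is now a theorem of the tree, by
  `Bordignon2020.bordignon2020_theorem13_of_noExceptionalZeroUpTo` (`ExplicitExceptionalZeroBoundsEvenDerivative.lean`).

WHAT THIS IS NOT: not a proof of Lu–Zaman–Zhao's Theorem 2.1 as printed (`LuZamanZhao2026.theorem21`
stays a named fact; only its restriction to `q ≤ 4·10⁵` is used and proved); nothing beyond `4·10⁵`;
nothing about `GeneralizedHardyLittlewood` or any summit statement.

## References

* W. Lu, A. Zaman, K. Zhao, *Dirichlet L-functions of quadratic characters have no exceptional zeros for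
  moduli up to 10¹⁰*, Math. Comp. (2026), arXiv:2602.03626, Theorem 1.1, §2.1–§3, Table 1. [LuZamanZhao2026]
* M. Bordignon, *Explicit bounds on exceptional zeroes of Dirichlet L-functions II*, J. Number Theory 210
  (2020) 481–487, Theorem 1.3. [Bordignon2020]
-/

namespace Literature.NumberTheory.LFunctions

namespace LuZamanZhao2026.Replay

set_option maxRecDepth 8192 in
/-- **The HEAVY layer at `c = 1/5` below `4·10⁵`**: every member `D` of `heavyList15` with
`direct D = false` is `CertifiedAt (1/5) D` — the 354 chunk-coverage theorems `heavyChunk<k>_covered`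
joined along `heavyList15 = heavyChunk1 ++ (heavyChunk2 ++ …)` by `heavy_forall_append`
(72 039 kernel-replayed certificates; nothing is computed here). [cite: LuZamanZhao2026, §2.1–§3, Table 1] -/
theorem heavyRows_fifth : ∀ D ∈ heavyList15, direct D = false → CertifiedAt (1 / 5) D := by
  unfold heavyList15
  exact (heavy_forall_append heavyChunk1_covered
    (heavy_forall_append heavyChunk2_covered
    (heavy_forall_append heavyChunk3_covered
    (heavy_forall_append heavyChunk4_covered
    (heavy_forall_append heavyChunk5_covered
    (heavy_forall_append heavyChunk6_covered
    (heavy_forall_append heavyChunk7_covered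
    (heavy_forall_append heavyChunk8_covered
    (heavy_forall_append heavyChunk9_covered
    (heavy_forall_append heavyChunk10_covered
    (heavy_forall_append heavyChunk11_covered
    (heavy_forall_append heavyChunk12_covered
    (heavy_forall_append heavyChunk13_covered
    (heavy_forall_append heavyChunk14_covered
    (heavy_forall_append heavyChunk15_covered
    (heavy_forall_append heavyChunk16_covered
    (heavy_forall_append heavyChunk17_covered
    (heavy_forall_append heavyChunk18_covered
    (heavy_forall_append heavyChunk19_covered
    (heavy_forall_append heavyChunk20_covered
    (heavy_forall_append heavyChunk21_covered
    (heavy_forall_append heavyChunk22_covered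
    (heavy_forall_append heavyChunk23_covered
    (heavy_forall_append heavyChunk24_covered
    (heavy_forall_append heavyChunk25_covered
    (heavy_forall_append heavyChunk26_covered
    (heavy_forall_append heavyChunk27_covered
    (heavy_forall_append heavyChunk28_covered
    (heavy_forall_append heavyChunk29_covered
    (heavy_forall_append heavyChunk30_covered
    (heavy_forall_append heavyChunk31_covered
    (heavy_forall_append heavyChunk32_covered
    (heavy_forall_append heavyChunk33_covered
    (heavy_forall_append heavyChunk34_covered
    (heavy_forall_append heavyChunk35_covered
    (heavy_forall_append heavyChunk36_covered
    (heavy_forall_append heavyChunk37_covered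
    (heavy_forall_append heavyChunk38_covered
    (heavy_forall_append heavyChunk39_covered
    (heavy_forall_append heavyChunk40_covered
    (heavy_forall_append heavyChunk41_covered
    (heavy_forall_append heavyChunk42_covered
    (heavy_forall_append heavyChunk43_covered
    (heavy_forall_append heavyChunk44_covered
    (heavy_forall_append heavyChunk45_covered
    (heavy_forall_append heavyChunk46_covered
    (heavy_forall_append heavyChunk47_covered
    (heavy_forall_append heavyChunk48_covered
    (heavy_forall_append heavyChunk49_covered
    (heavy_forall_append heavyChunk50_covered
    (heavy_forall_append heavyChunk51_covered
    (heavy_forall_append heavyChunk52_covered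
    (heavy_forall_append heavyChunk53_covered
    (heavy_forall_append heavyChunk54_covered
    (heavy_forall_append heavyChunk55_covered
    (heavy_forall_append heavyChunk56_covered
    (heavy_forall_append heavyChunk57_covered
    (heavy_forall_append heavyChunk58_covered
    (heavy_forall_append heavyChunk59_covered
    (heavy_forall_append heavyChunk60_covered
    (heavy_forall_append heavyChunk61_covered
    (heavy_forall_append heavyChunk62_covered
    (heavy_forall_append heavyChunk63_covered
    (heavy_forall_append heavyChunk64_covered
    (heavy_forall_append heavyChunk65_covered
    (heavy_forall_append heavyChunk66_covered
    (heavy_forall_append heavyChunk67_covered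
    (heavy_forall_append heavyChunk68_covered
    (heavy_forall_append heavyChunk69_covered
    (heavy_forall_append heavyChunk70_covered
    (heavy_forall_append heavyChunk71_covered
    (heavy_forall_append heavyChunk72_covered
    (heavy_forall_append heavyChunk73_covered
    (heavy_forall_append heavyChunk74_covered
    (heavy_forall_append heavyChunk75_covered
    (heavy_forall_append heavyChunk76_covered
    (heavy_forall_append heavyChunk77_covered
    (heavy_forall_append heavyChunk78_covered
    (heavy_forall_append heavyChunk79_covered
    (heavy_forall_append heavyChunk80_covered
    (heavy_forall_append heavyChunk81_covered
    (heavy_forall_append heavyChunk82_covered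
    (heavy_forall_append heavyChunk83_covered
    (heavy_forall_append heavyChunk84_covered
    (heavy_forall_append heavyChunk85_covered
    (heavy_forall_append heavyChunk86_covered
    (heavy_forall_append heavyChunk87_covered
    (heavy_forall_append heavyChunk88_covered
    (heavy_forall_append heavyChunk89_covered
    (heavy_forall_append heavyChunk90_covered
    (heavy_forall_append heavyChunk91_covered
    (heavy_forall_append heavyChunk92_covered
    (heavy_forall_append heavyChunk93_covered
    (heavy_forall_append heavyChunk94_covered
    (heavy_forall_append heavyChunk95_covered
    (heavy_forall_append heavyChunk96_covered
    (heavy_forall_append heavyChunk97_covered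
    (heavy_forall_append heavyChunk98_covered
    (heavy_forall_append heavyChunk99_covered
    (heavy_forall_append heavyChunk100_covered
    (heavy_forall_append heavyChunk101_covered
    (heavy_forall_append heavyChunk102_covered
    (heavy_forall_append heavyChunk103_covered
    (heavy_forall_append heavyChunk104_covered
    (heavy_forall_append heavyChunk105_covered
    (heavy_forall_append heavyChunk106_covered
    (heavy_forall_append heavyChunk107_covered
    (heavy_forall_append heavyChunk108_covered
    (heavy_forall_append heavyChunk109_covered
    (heavy_forall_append heavyChunk110_covered
    (heavy_forall_append heavyChunk111_covered
    (heavy_forall_append heavyChunk112_covered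
    (heavy_forall_append heavyChunk113_covered
    (heavy_forall_append heavyChunk114_covered
    (heavy_forall_append heavyChunk115_covered
    (heavy_forall_append heavyChunk116_covered
    (heavy_forall_append heavyChunk117_covered
    (heavy_forall_append heavyChunk118_covered
    (heavy_forall_append heavyChunk119_covered
    (heavy_forall_append heavyChunk120_covered
    (heavy_forall_append heavyChunk121_covered
    (heavy_forall_append heavyChunk122_covered
    (heavy_forall_append heavyChunk123_covered
    (heavy_forall_append heavyChunk124_covered
    (heavy_forall_append heavyChunk125_covered
    (heavy_forall_append heavyChunk126_covered
    (heavy_forall_append heavyChunk127_covered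
    (heavy_forall_append heavyChunk128_covered
    (heavy_forall_append heavyChunk129_covered
    (heavy_forall_append heavyChunk130_covered
    (heavy_forall_append heavyChunk131_covered
    (heavy_forall_append heavyChunk132_covered
    (heavy_forall_append heavyChunk133_covered
    (heavy_forall_append heavyChunk134_covered
    (heavy_forall_append heavyChunk135_covered
    (heavy_forall_append heavyChunk136_covered
    (heavy_forall_append heavyChunk137_covered
    (heavy_forall_append heavyChunk138_covered
    (heavy_forall_append heavyChunk139_covered
    (heavy_forall_append heavyChunk140_covered
    (heavy_forall_append heavyChunk141_covered
    (heavy_forall_append heavyChunk142_covered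
    (heavy_forall_append heavyChunk143_covered
    (heavy_forall_append heavyChunk144_covered
    (heavy_forall_append heavyChunk145_covered
    (heavy_forall_append heavyChunk146_covered
    (heavy_forall_append heavyChunk147_covered
    (heavy_forall_append heavyChunk148_covered
    (heavy_forall_append heavyChunk149_covered
    (heavy_forall_append heavyChunk150_covered
    (heavy_forall_append heavyChunk151_covered
    (heavy_forall_append heavyChunk152_covered
    (heavy_forall_append heavyChunk153_covered
    (heavy_forall_append heavyChunk154_covered
    (heavy_forall_append heavyChunk155_covered
    (heavy_forall_append heavyChunk156_covered
    (heavy_forall_append heavyChunk157_covered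
    (heavy_forall_append heavyChunk158_covered
    (heavy_forall_append heavyChunk159_covered
    (heavy_forall_append heavyChunk160_covered
    (heavy_forall_append heavyChunk161_covered
    (heavy_forall_append heavyChunk162_covered
    (heavy_forall_append heavyChunk163_covered
    (heavy_forall_append heavyChunk164_covered
    (heavy_forall_append heavyChunk165_covered
    (heavy_forall_append heavyChunk166_covered
    (heavy_forall_append heavyChunk167_covered
    (heavy_forall_append heavyChunk168_covered
    (heavy_forall_append heavyChunk169_covered
    (heavy_forall_append heavyChunk170_covered
    (heavy_forall_append heavyChunk171_covered
    (heavy_forall_append heavyChunk172_covered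
    (heavy_forall_append heavyChunk173_covered
    (heavy_forall_append heavyChunk174_covered
    (heavy_forall_append heavyChunk175_covered
    (heavy_forall_append heavyChunk176_covered
    (heavy_forall_append heavyChunk177_covered
    (heavy_forall_append heavyChunk178_covered
    (heavy_forall_append heavyChunk179_covered
    (heavy_forall_append heavyChunk180_covered
    (heavy_forall_append heavyChunk181_covered
    (heavy_forall_append heavyChunk182_covered
    (heavy_forall_append heavyChunk183_covered
    (heavy_forall_append heavyChunk184_covered
    (heavy_forall_append heavyChunk185_covered
    (heavy_forall_append heavyChunk186_covered
    (heavy_forall_append heavyChunk187_covered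
    (heavy_forall_append heavyChunk188_covered
    (heavy_forall_append heavyChunk189_covered
    (heavy_forall_append heavyChunk190_covered
    (heavy_forall_append heavyChunk191_covered
    (heavy_forall_append heavyChunk192_covered
    (heavy_forall_append heavyChunk193_covered
    (heavy_forall_append heavyChunk194_covered
    (heavy_forall_append heavyChunk195_covered
    (heavy_forall_append heavyChunk196_covered
    (heavy_forall_append heavyChunk197_covered
    (heavy_forall_append heavyChunk198_covered
    (heavy_forall_append heavyChunk199_covered
    (heavy_forall_append heavyChunk200_covered
    (heavy_forall_append heavyChunk201_covered
    (heavy_forall_append heavyChunk202_covered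
    (heavy_forall_append heavyChunk203_covered
    (heavy_forall_append heavyChunk204_covered
    (heavy_forall_append heavyChunk205_covered
    (heavy_forall_append heavyChunk206_covered
    (heavy_forall_append heavyChunk207_covered
    (heavy_forall_append heavyChunk208_covered
    (heavy_forall_append heavyChunk209_covered
    (heavy_forall_append heavyChunk210_covered
    (heavy_forall_append heavyChunk211_covered
    (heavy_forall_append heavyChunk212_covered
    (heavy_forall_append heavyChunk213_covered
    (heavy_forall_append heavyChunk214_covered
    (heavy_forall_append heavyChunk215_covered
    (heavy_forall_append heavyChunk216_covered
    (heavy_forall_append heavyChunk217_covered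
    (heavy_forall_append heavyChunk218_covered
    (heavy_forall_append heavyChunk219_covered
    (heavy_forall_append heavyChunk220_covered
    (heavy_forall_append heavyChunk221_covered
    (heavy_forall_append heavyChunk222_covered
    (heavy_forall_append heavyChunk223_covered
    (heavy_forall_append heavyChunk224_covered
    (heavy_forall_append heavyChunk225_covered
    (heavy_forall_append heavyChunk226_covered
    (heavy_forall_append heavyChunk227_covered
    (heavy_forall_append heavyChunk228_covered
    (heavy_forall_append heavyChunk229_covered
    (heavy_forall_append heavyChunk230_covered
    (heavy_forall_append heavyChunk231_covered
    (heavy_forall_append heavyChunk232_covered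
    (heavy_forall_append heavyChunk233_covered
    (heavy_forall_append heavyChunk234_covered
    (heavy_forall_append heavyChunk235_covered
    (heavy_forall_append heavyChunk236_covered
    (heavy_forall_append heavyChunk237_covered
    (heavy_forall_append heavyChunk238_covered
    (heavy_forall_append heavyChunk239_covered
    (heavy_forall_append heavyChunk240_covered
    (heavy_forall_append heavyChunk241_covered
    (heavy_forall_append heavyChunk242_covered
    (heavy_forall_append heavyChunk243_covered
    (heavy_forall_append heavyChunk244_covered
    (heavy_forall_append heavyChunk245_covered
    (heavy_forall_append heavyChunk246_covered
    (heavy_forall_append heavyChunk247_covered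
    (heavy_forall_append heavyChunk248_covered
    (heavy_forall_append heavyChunk249_covered
    (heavy_forall_append heavyChunk250_covered
    (heavy_forall_append heavyChunk251_covered
    (heavy_forall_append heavyChunk252_covered
    (heavy_forall_append heavyChunk253_covered
    (heavy_forall_append heavyChunk254_covered
    (heavy_forall_append heavyChunk255_covered
    (heavy_forall_append heavyChunk256_covered
    (heavy_forall_append heavyChunk257_covered
    (heavy_forall_append heavyChunk258_covered
    (heavy_forall_append heavyChunk259_covered
    (heavy_forall_append heavyChunk260_covered
    (heavy_forall_append heavyChunk261_covered
    (heavy_forall_append heavyChunk262_covered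
    (heavy_forall_append heavyChunk263_covered
    (heavy_forall_append heavyChunk264_covered
    (heavy_forall_append heavyChunk265_covered
    (heavy_forall_append heavyChunk266_covered
    (heavy_forall_append heavyChunk267_covered
    (heavy_forall_append heavyChunk268_covered
    (heavy_forall_append heavyChunk269_covered
    (heavy_forall_append heavyChunk270_covered
    (heavy_forall_append heavyChunk271_covered
    (heavy_forall_append heavyChunk272_covered
    (heavy_forall_append heavyChunk273_covered
    (heavy_forall_append heavyChunk274_covered
    (heavy_forall_append heavyChunk275_covered
    (heavy_forall_append heavyChunk276_covered
    (heavy_forall_append heavyChunk277_covered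
    (heavy_forall_append heavyChunk278_covered
    (heavy_forall_append heavyChunk279_covered
    (heavy_forall_append heavyChunk280_covered
    (heavy_forall_append heavyChunk281_covered
    (heavy_forall_append heavyChunk282_covered
    (heavy_forall_append heavyChunk283_covered
    (heavy_forall_append heavyChunk284_covered
    (heavy_forall_append heavyChunk285_covered
    (heavy_forall_append heavyChunk286_covered
    (heavy_forall_append heavyChunk287_covered
    (heavy_forall_append heavyChunk288_covered
    (heavy_forall_append heavyChunk289_covered
    (heavy_forall_append heavyChunk290_covered
    (heavy_forall_append heavyChunk291_covered
    (heavy_forall_append heavyChunk292_covered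
    (heavy_forall_append heavyChunk293_covered
    (heavy_forall_append heavyChunk294_covered
    (heavy_forall_append heavyChunk295_covered
    (heavy_forall_append heavyChunk296_covered
    (heavy_forall_append heavyChunk297_covered
    (heavy_forall_append heavyChunk298_covered
    (heavy_forall_append heavyChunk299_covered
    (heavy_forall_append heavyChunk300_covered
    (heavy_forall_append heavyChunk301_covered
    (heavy_forall_append heavyChunk302_covered
    (heavy_forall_append heavyChunk303_covered
    (heavy_forall_append heavyChunk304_covered
    (heavy_forall_append heavyChunk305_covered
    (heavy_forall_append heavyChunk306_covered
    (heavy_forall_append heavyChunk307_covered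
    (heavy_forall_append heavyChunk308_covered
    (heavy_forall_append heavyChunk309_covered
    (heavy_forall_append heavyChunk310_covered
    (heavy_forall_append heavyChunk311_covered
    (heavy_forall_append heavyChunk312_covered
    (heavy_forall_append heavyChunk313_covered
    (heavy_forall_append heavyChunk314_covered
    (heavy_forall_append heavyChunk315_covered
    (heavy_forall_append heavyChunk316_covered
    (heavy_forall_append heavyChunk317_covered
    (heavy_forall_append heavyChunk318_covered
    (heavy_forall_append heavyChunk319_covered
    (heavy_forall_append heavyChunk320_covered
    (heavy_forall_append heavyChunk321_covered
    (heavy_forall_append heavyChunk322_covered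
    (heavy_forall_append heavyChunk323_covered
    (heavy_forall_append heavyChunk324_covered
    (heavy_forall_append heavyChunk325_covered
    (heavy_forall_append heavyChunk326_covered
    (heavy_forall_append heavyChunk327_covered
    (heavy_forall_append heavyChunk328_covered
    (heavy_forall_append heavyChunk329_covered
    (heavy_forall_append heavyChunk330_covered
    (heavy_forall_append heavyChunk331_covered
    (heavy_forall_append heavyChunk332_covered
    (heavy_forall_append heavyChunk333_covered
    (heavy_forall_append heavyChunk334_covered
    (heavy_forall_append heavyChunk335_covered
    (heavy_forall_append heavyChunk336_covered
    (heavy_forall_append heavyChunk337_covered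
    (heavy_forall_append heavyChunk338_covered
    (heavy_forall_append heavyChunk339_covered
    (heavy_forall_append heavyChunk340_covered
    (heavy_forall_append heavyChunk341_covered
    (heavy_forall_append heavyChunk342_covered
    (heavy_forall_append heavyChunk343_covered
    (heavy_forall_append heavyChunk344_covered
    (heavy_forall_append heavyChunk345_covered
    (heavy_forall_append heavyChunk346_covered
    (heavy_forall_append heavyChunk347_covered
    (heavy_forall_append heavyChunk348_covered
    (heavy_forall_append heavyChunk349_covered
    (heavy_forall_append heavyChunk350_covered
    (heavy_forall_append heavyChunk351_covered
    (heavy_forall_append heavyChunk352_covered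
    (heavy_forall_append heavyChunk353_covered
    heavyChunk354_covered)))))))))))))))))))))))))))))))))))))))))))))))))))))))))))))))))))))))))))))))))))))))))))))))))))))))))))))))))))))))))))))))))))))))))))))))))))))))))))))))))))))))))))))))))))))))))))))))))))))))))))))))))))))))))))))))))))))))))))))))))))))))))))))))))))))))))))))))))))))))))))))))))))))))))))))))))))))))))))))))))))))))))))))))))))))))))))))))))

/-- **`NoExceptionalZeroUpTo 400000 (1/5)`, UNCONDITIONAL**: from the light layer, the heavy layer and
`theorem21UpTo_fourHundredThousand`, by the LIGHT/HEAVY glue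
`noExceptionalZeroUpTo_of_light_heavy_upTo`. [cite: LuZamanZhao2026, Theorem 1.1] -/
theorem noExceptionalZeroUpTo_fourHundredThousand_fifth : NoExceptionalZeroUpTo 400000 (1 / 5) :=
  noExceptionalZeroUpTo_of_light_heavy_upTo theorem21UpTo_fourHundredThousand lzzReplayK_lightRows
    heavyRows_fifth

end LuZamanZhao2026.Replay

/-- **EXACT discharge of the leaf `NoExceptionalZeroUpTo_4e5_fifth`** (`RealCharacterLadderLeaves.lean`):
for every modulus `3 ≤ q ≤ 4·10⁵`, every primitive quadratic character `χ` mod `q` and every real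
`σ ∈ (0, 1]` with `σ ≥ 1 − 1/(5 log q)`, `L(σ, χ) ≠ 0`. Standard axioms; trust base = the Lean kernel
(243 107 replayed Table-1 certificates, the base tables `q ≤ 52` / odd `q ≤ 163`, and the proved
restriction `theorem21UpTo 400000` of Lu–Zaman–Zhao's Theorem 2.1). [cite: LuZamanZhao2026, Theorem 1.1] -/
theorem NoExceptionalZeroUpTo_4e5_fifth_holds : NoExceptionalZeroUpTo_4e5_fifth :=
  LuZamanZhao2026.Replay.noExceptionalZeroUpTo_fourHundredThousand_fifth

/-- **EXACT discharge of `bordignon2020_theorem13`** (Bordignon 2020, Theorem 1.3 as printed: for an even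
non-principal real character `χ` mod `q > 4·10⁵` and a real zero `β₀` of `L(s, χ)` in McCurley's region,
`β₀ ≤ 1 − 100/(√q log² q)`), by the tree's reduction to the leaf
(`Bordignon2020.bordignon2020_theorem13_of_noExceptionalZeroUpTo`) and `NoExceptionalZeroUpTo_4e5_fifth_holds`.
[cite: Bordignon2020, Theorem 1.3] [cite: LuZamanZhao2026, Theorem 1.1] -/
theorem bordignon2020_theorem13_holds : bordignon2020_theorem13 :=
  Bordignon2020.bordignon2020_theorem13_of_noExceptionalZeroUpTo NoExceptionalZeroUpTo_4e5_fifth_holds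

end Literature.NumberTheory.LFunctions
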